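import Literature.NumberTheory.ComplexMultiplication.ReflexDegreeQuadraticSubfieldBound
import Literature.NumberTheory.ComplexMultiplication.QuarticCMTypes
import Literature.AlgebraicGeometry.Pohlmann1968.SimpleCMFourfoldNondegenerate
import Literature.AlgebraicGeometry.Pohlmann1968.MumfordSimpleFourfold
import HarnessLib

/-!
# Degenerate simple CM abelian fourfolds are the reflexes of sextic CM types, and their Galois group is
# `ℤ₂ × A₄` or `ℤ₂ × S₄` (Dodson 1984, §3.3.2 Theorem — the refinement)

B. Dodson, *The structure of Galois groups of CM-fields*, Trans. AMS **283** (1984) [Dodson1984] (held text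
`paper:doi-10-2307-1999987`), §3.3.2 Theorem (p. 16, L44–47; proof p. 17, L1–4):

> "Let `A` be a simple Abelian variety of CM-type `(K, Φ)`, with `dim_ℂ(A) = 4`.  Then `A` is degenerate if and
> only if `Gal(Kᶜ/ℚ) = ℤ₂ × A₄`, or `ℤ₂ × S₄` and `(K, Φ)` is the reflex of a type on a CM-field of degree `6`."
> Proof. "The essential observation will be made in the proposition of §5.2.2, where the cocycle analysis
> establishes that there are only six orbits in question … The minimal weight criterion establishes nondegeneracy
> for the other five cases."

with §3.1.0 (p. 11, L33–36): "Recall that `rank(K, Φ) = rank(K′, Φ′)` (Kubota [8] or Shimura [22]), so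
`[K′ : ℚ] ≥ [K : ℚ]` is a necessary condition for `(K, Φ)` to be nondegenerate … `(K′)′ ⊂ K`, with `(K′)′ = K` if
and only if `(K, Φ)` is primitive."

Here `A` simple ⟺ `Φ` primitive (Shimura §8.2 Prop. 26), "degenerate" = Kubota rank `t(Φ) < n + 1 = 5`
(the tree's `¬ IsNondegenerate Φ`), and for a primitive `Φ` "`(K, Φ)` is the reflex of a type on a CM-field of
degree `6`" says exactly that the reflex field `K′ = K′(Φ)` has degree `6` (then `(K, Φ)` is the reflex of its own
reflex `(K′, Φ′)`, Streng Lemma 7.2 / tree `image_typeLift_reflexType_reflexType`).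

## What is proved (a NEW proof; the print argues from the table of the `38` `ρ`-structures for `n = 4`, §5.2)

The COR-CM binder seat b04 proved the forward direction of Dodson's theorem in AUTOMORPHISM form
(`Summits/HodgeConjecture/CorCM/OcticCMFieldAutomorphismsNondegenerate`: a degenerate simple CM fourfold has
`Aut(K/ℚ) = {1, c}`), classification-free, from the tree's Moonen–Zarhin/Gordon criterion
`Pohlmann1968.isNondegenerate_iff_forall_not_weilFibre` (a primitive octic CM type is degenerate iff `K` has an
imaginary quadratic subfield `k` over which `Φ` has multiplicities `(2,2)`), and recorded as NOT done "Dodson's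
refinement `Φ` is the reflex of a sextic type" and (stated informally only) "the closure of `K⁺` is `A₄` or `S₄`".
This file proves both, again without the classification, for a CM field `K` of degree `8`, a PRIMITIVE CM type `Φ`
of `K` (base point `φ₀`), `L/ℚ` a Galois CM field receiving `K` by `j`, `ι : L → ℂ`, `K′ = reflexField ℚ L (algValuedIn ι Φ)`:

* **`six_le_finrank_reflexField_of_isPrimitive`** — `6 ≤ [K′ : ℚ]` for EVERY primitive octic type (Ribet's
  `log₂` bound gives rank `≥ 4`, and rank `= rank(Φ′) ≤ [K′:ℚ]/2 + 1`, Shimura §32.10);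
* **`finrank_reflexField_le_six_of_not_isNondegenerate`** — a DEGENERATE primitive octic type has `[K′ : ℚ] ≤ 6`:
  by Moonen–Zarhin `Φ` has multiplicities `(2,2)` over an imaginary quadratic subfield `k`, so (Dodson §3.1.1,
  `ReflexDegreeQuadraticSubfieldBound`: "the `G`-orbit of `f` is `G₀*(f) ∪ G₀*(ρf)`") its Galois translates inject
  into the `2`-subsets of the `4`-element block, `[K′ : ℚ] = |G • Φ| ≤ C(4,2) = 6`;
* hence **`finrank_reflexField_eq_six_of_not_isNondegenerate`** (`[K′ : ℚ] = 6`: "`(K, Φ)` is the reflex of a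
  type on a CM-field of degree `6`"), **`not_isNondegenerate_iff_finrank_reflexField_eq_six`** (Dodson's theorem in
  reflex form: degenerate ⟺ `[K′ : ℚ] = 6`), **`isNondegenerate_iff_finrank_le_finrank_reflexField`** (for simple
  CM fourfolds Kubota's NECESSARY condition `[K′ : ℚ] ≥ [K : ℚ]` is also SUFFICIENT),
  `finrank_reflexField_eq_six_or_eight_le` (the reflex degree of a primitive octic type is `6` or `≥ 8`), and
  `reflexField_reflexType_eq_of_not_isNondegenerate` (`K″ = j(K)`: `(K, Φ)` IS the reflex of the sextic pair `(K′, Φ′)`);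
* the Galois group, for `L = Kᶜ` a normal closure: **`finrank_normalClosure_eq_of_not_isNondegenerate`**
  (`[Kᶜ : ℚ] = |Gal(Kᶜ/ℚ)| ∈ {24, 48}`), `finrank_normalClosure_maximalRealSubfield_eq_two_of_not_isNondegenerate`
  (`[Kᶜ : K₀ᶜ] = 2`, i.e. `v = 1`: `Gal(Kᶜ/ℚ) = ⟨ρ⟩ × G₀`), and, at the level of a finite group `G` acting faithfully
  and transitively on `E` with a `4`-element block `E₀` and `3 ∣ |G|` (**`IsCMTypeWith.card_stabilizer_eq_of_block_four`**,
  **`IsCMTypeWith.range_toPermHom_eq_of_block_four`**, **`IsCMTypeWith.nonempty_mulEquiv_of_block_four`**):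
  `|G₀| ∈ {12, 24}`, the image of `G₀ = Stab(E₀)` in `Sym(E₀)` is the alternating or the symmetric group, and
  **`G ≃ ℤ₂ × A₄` or `G ≃ ℤ₂ × S₄`**; read on `Gal(Kᶜ/ℚ)`: **`nonempty_mulEquiv_gal_of_not_isNondegenerate`**
  ("`Gal(Kᶜ/ℚ) = ℤ₂ × A₄, or ℤ₂ × S₄`").

* the example (non-vacuity): for Mumford–Pohlmann's simple CM fourfolds (tree `Pohlmann1968/MumfordSimpleFourfold`:
  `K = F(i)`, `F = ℚ(α)`, `3α⁴ - 6α² + α + 1 = 0`, Weil type `Φ_P` for `ℚ(i)`, primitive and degenerate) the reflex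
  field is SEXTIC and `[Kᶜ : ℚ] ∈ {24, 48}` (**`MumfordFourfold.finrank_reflexField_weilType_eq_six`**,
  `MumfordFourfold.finrank_normalClosure_eq`).

KERNEL ONLY: theorems, no definition, no named fact (D-0014/D-0026).  Count-neutral for COR-CM; `HC_CM` is neither
used nor mentioned.  NOT here: the converse existence statement (both groups occur: Mumford's example in the tree,
`Pohlmann1968/MumfordSimpleFourfold`, is the `S₄` case; the `A₄` case needs a totally real quartic field with Galois
group `A₄`, Dodson §2.2.1 Theorem), and the `38` `ρ`-structures of §5.2.

## References

* [Dodson1984] B. Dodson, Trans. AMS 283 (1984) 1–32: §3.1.0 (p. 11), §3.1.1 (pp. 11–12), §3.3.2 Theorem (pp. 16–17).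
* [Ribet1980] K. A. Ribet, *Division fields of abelian varieties with complex multiplication*, Mém. SMF 2 (1980),
  §3 (3.4)–(3.7) (pp. 86–88): "if `d = 4` … `4 ≤ rank(E,S) ≤ 5` and both possibilities may occur … if `d′ = 3` we
  have `rank(E,S) = 4`".
* [MoonenZarhin1995Duke] B. Moonen, Yu. Zarhin, Duke Math. J. 77 (1995), Thm. 2.4; [Gordon1999HodgeAVSurvey] 5.13.
* [Shimura1998] G. Shimura, *Abelian varieties with complex multiplication and modular functions*, §8.2 Prop. 26,
  §8.3 Prop. 28, §32.10.
-/

set_option autoImplicit false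

open scoped Pointwise

namespace Literature.NumberTheory.ComplexMultiplication

/-! ## Part I — group level: a `4`-element block and `3 ∣ |G|` force `G₀ ∈ {A₄, S₄}` and `G ≃ ℤ₂ × G₀` -/

section GroupLevel

variable {G : Type*} [Group G] {E : Type*} [MulAction G E] {ρ : G} {Φ E₀ : Set E}

namespace IsCMTypeWith

/-- **`|G₀| ∈ {12, 24}`**: for a finite group `G` acting faithfully and transitively on `E` with a `4`-element block
`E₀` (a CM type mapped by every element onto `E₀` or `ρE₀`), if `3 ∣ |G|` then the stabiliser `G₀` of the block has
order `12` or `24` (`G₀` is a transitive subgroup of `Sym(E₀) ≅ S₄` of order divisible by `3`; `|G| = 2|G₀|`).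
[cite: Dodson1984, §3.3.2 Theorem] -/
theorem card_stabilizer_eq_of_block_four [FaithfulSMul G E] [Finite E] [Finite G]
    [MulAction.IsPretransitive G E] (h₀ : IsCMTypeWith ρ E₀) (hG : ∀ g : G, g • E₀ = E₀ ∨ g • E₀ = ρ • E₀)
    (h4 : E₀.ncard = 4) (h3 : 3 ∣ Nat.card G) :
    Nat.card (MulAction.stabilizer G E₀) = 12 ∨ Nat.card (MulAction.stabilizer G E₀) = 24 := by
  have hne : E₀.Nonempty := Set.nonempty_of_ncard_ne_zero (by rw [h4]; norm_num)
  haveI : Nonempty E := ⟨hne.some⟩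
  have h2 := h₀.card_eq_two_mul_card_stabilizer_of_block hG
  have hdvd24 := h₀.card_stabilizer_dvd_factorial_of_block
  rw [h4, show Nat.factorial 4 = 24 by decide] at hdvd24
  have h4dvd := h₀.ncard_dvd_card_stabilizer_of_block hne hG
  rw [h4] at h4dvd
  have h3' : 3 ∣ Nat.card (MulAction.stabilizer G E₀) := by
    rw [h2] at h3
    exact (Nat.Coprime.dvd_mul_left (by norm_num : Nat.Coprime 3 2)).1 h3
  have h12 : 12 ∣ Nat.card (MulAction.stabilizer G E₀) :=
    Nat.Coprime.mul_dvd_of_dvd_of_dvd (by norm_num : Nat.Coprime 4 3) h4dvd h3'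
  obtain ⟨a, ha⟩ := h12
  obtain ⟨b, hb⟩ := hdvd24
  have hpos : 0 < Nat.card (MulAction.stabilizer G E₀) := Nat.card_pos
  rw [ha] at hb hpos ⊢
  have hab : a * b = 2 := by
    have : 12 * (a * b) = 12 * 2 := by rw [← mul_assoc, ← hb]
    omega
  have ha2 : a ∣ 2 := ⟨b, hab.symm⟩
  have ha' : a ≤ 2 := Nat.le_of_dvd (by norm_num) ha2
  interval_cases a <;> omega

/-- **`|G| ∈ {24, 48}`** under the same hypotheses ("`Gal(Kᶜ/ℚ) = ℤ₂ × A₄`, or `ℤ₂ × S₄`").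
[cite: Dodson1984, §3.3.2 Theorem] -/
theorem card_eq_of_block_four [FaithfulSMul G E] [Finite E] [Finite G] [MulAction.IsPretransitive G E]
    (h₀ : IsCMTypeWith ρ E₀) (hG : ∀ g : G, g • E₀ = E₀ ∨ g • E₀ = ρ • E₀) (h4 : E₀.ncard = 4)
    (h3 : 3 ∣ Nat.card G) : Nat.card G = 24 ∨ Nat.card G = 48 := by
  have hne : E₀.Nonempty := Set.nonempty_of_ncard_ne_zero (by rw [h4]; norm_num)
  haveI : Nonempty E := ⟨hne.some⟩
  have h2 := h₀.card_eq_two_mul_card_stabilizer_of_block hG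
  rcases h₀.card_stabilizer_eq_of_block_four hG h4 h3 with h | h <;> omega

/-- `|Sym(E₀)| = 24` for a `4`-element block. [folklore] -/
private theorem card_perm_block_eq [Finite E] (h4 : E₀.ncard = 4) : Nat.card (Equiv.Perm E₀) = 24 := by
  classical
  haveI : Fintype E := Fintype.ofFinite E
  rw [Nat.card_perm, Nat.card_coe_set_eq, h4]
  decide

open scoped Classical in
/-- **The image of `G₀` in `Sym(E₀) ≅ S₄` is the alternating group or the whole symmetric group** (a subgroup of
`S₄` of order `12` has index `2`, hence is `A₄` — Mathlib `Equiv.Perm.eq_alternatingGroup_of_index_eq_two`; order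
`24` is everything). [cite: Dodson1984, §3.3.2 Theorem] -/
theorem range_toPermHom_eq_of_block_four [FaithfulSMul G E] [Finite E] [Finite G]
    [MulAction.IsPretransitive G E] (h₀ : IsCMTypeWith ρ E₀) (hG : ∀ g : G, g • E₀ = E₀ ∨ g • E₀ = ρ • E₀)
    (h4 : E₀.ncard = 4) (h3 : 3 ∣ Nat.card G) :
    letI : Fintype E₀ := Fintype.ofFinite E₀
    (MulAction.toPermHom (MulAction.stabilizer G E₀) E₀).range = alternatingGroup E₀ ∨
      (MulAction.toPermHom (MulAction.stabilizer G E₀) E₀).range = ⊤ := by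
  letI : Fintype E₀ := Fintype.ofFinite E₀
  haveI := h₀.faithfulSMul_stabilizer_of_block
  have hinj : Function.Injective (MulAction.toPermHom (MulAction.stabilizer G E₀) E₀) :=
    MulAction.toPerm_injective
  set R := (MulAction.toPermHom (MulAction.stabilizer G E₀) E₀).range with hR
  have hcardR : Nat.card R = Nat.card (MulAction.stabilizer G E₀) :=
    (Nat.card_congr (MonoidHom.ofInjective hinj).toEquiv).symm
  have h24 := card_perm_block_eq (E₀ := E₀) h4
  rcases h₀.card_stabilizer_eq_of_block_four hG h4 h3 with h12 | h24'
  · left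
    have hidx : R.index = 2 := by
      have := R.index_mul_card
      rw [hcardR, h12, h24] at this
      omega
    exact Equiv.Perm.eq_alternatingGroup_of_index_eq_two hidx
  · right
    apply Subgroup.eq_top_of_card_eq
    rw [hcardR, h24', h24]

/-! ### `G ≃ ℤ₂ × G₀` and the abstract groups `ℤ₂ × A₄`, `ℤ₂ × S₄` -/

/-- `ρ` commutes with every element (faithful action). [cite: Dodson1984, §2.1.1 Remark 1] -/
theorem rho_mul_comm [FaithfulSMul G E] (h₀ : IsCMTypeWith ρ E₀) (g : G) : ρ * g = g * ρ :=
  eq_of_smul_eq_smul (α := E) fun x => by rw [mul_smul, mul_smul, h₀.comm]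

/-- `ρ² = 1` (faithful action). [cite: Dodson1984, §2.1.1 Remark 1] -/
theorem rho_mul_rho [FaithfulSMul G E] (h₀ : IsCMTypeWith ρ E₀) : ρ * ρ = 1 :=
  eq_of_smul_eq_smul (α := E) fun x => by rw [mul_smul, one_smul, h₀.invol]

/-- `ρ ∉ G₀`. [cite: Dodson1984, §3.1.1 Theorem (proof)] -/
theorem rho_notMem_stabilizer [Nonempty E] (h₀ : IsCMTypeWith ρ E₀) : ρ ∉ MulAction.stabilizer G E₀ :=
  fun h => h₀.rho_smul_set_ne h

/-- The elements of `⟨ρ⟩` are `1` and `ρ`. [folklore] -/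
private theorem mem_zpowers_rho_iff [FaithfulSMul G E] (h₀ : IsCMTypeWith ρ E₀) (g : G) :
    g ∈ Subgroup.zpowers ρ ↔ g = 1 ∨ g = ρ := by
  constructor
  · intro hg
    obtain ⟨k, rfl⟩ := Subgroup.mem_zpowers_iff.1 hg
    have h2 : ρ ^ (2 : ℤ) = 1 := by rw [zpow_two]; exact h₀.rho_mul_rho
    obtain ⟨m, hm | hm⟩ := Int.even_or_odd' k
    · exact Or.inl (by rw [hm, zpow_mul, h2, one_zpow])
    · exact Or.inr (by rw [hm, zpow_add, zpow_mul, h2, one_zpow, one_mul, zpow_one])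
  · rintro (h1 | h1) <;> rw [h1]
    exacts [Subgroup.one_mem _, Subgroup.mem_zpowers ρ]

/-- `⟨ρ⟩` has order `2`. [cite: Dodson1984, §3.1.1 Theorem] -/
theorem card_zpowers_rho [FaithfulSMul G E] [Nonempty E] (h₀ : IsCMTypeWith ρ E₀) :
    Nat.card (Subgroup.zpowers ρ) = 2 := by
  have hρ1 : (ρ : G) ≠ 1 := fun h1 => by
    obtain ⟨x⟩ := ‹Nonempty E›
    exact h₀.rho_smul_ne x (by rw [h1, one_smul])
  have hset : ((Subgroup.zpowers ρ : Subgroup G) : Set G) = {1, ρ} := by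
    ext g
    simp only [SetLike.mem_coe, Set.mem_insert_iff, Set.mem_singleton_iff]
    exact h₀.mem_zpowers_rho_iff g
  change Nat.card ((Subgroup.zpowers ρ : Subgroup G) : Set G) = 2
  rw [hset, Nat.card_coe_set_eq, Set.ncard_pair hρ1.symm]

/-- **`G₀` and `⟨ρ⟩` are complementary** ("the trivial `ρ`-structure with `v = 1` on `⟨ρ⟩ × G₀`").
[cite: Dodson1984, §3.1.1 Theorem] -/
theorem isComplement'_stabilizer_zpowers_rho [FaithfulSMul G E] [Finite G] [Nonempty E]
    (h₀ : IsCMTypeWith ρ E₀) (hG : ∀ g : G, g • E₀ = E₀ ∨ g • E₀ = ρ • E₀) :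
    (MulAction.stabilizer G E₀).IsComplement' (Subgroup.zpowers ρ) := by
  refine Subgroup.isComplement'_of_card_mul_and_disjoint ?_ ?_
  · rw [h₀.card_zpowers_rho, h₀.card_eq_two_mul_card_stabilizer_of_block hG, mul_comm]
  · rw [disjoint_iff, eq_bot_iff]
    intro g hg
    rw [Subgroup.mem_inf] at hg
    rcases (h₀.mem_zpowers_rho_iff g).1 hg.2 with h1 | h1
    · exact h1 ▸ Subgroup.one_mem _
    · exact absurd (h1 ▸ hg.1) h₀.rho_notMem_stabilizer

/-- **`G ≃ G₀ × ⟨ρ⟩`** as groups (`ρ` is central). [cite: Dodson1984, §3.1.1 Theorem] -/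
theorem nonempty_mulEquiv_stabilizer_prod_zpowers [FaithfulSMul G E] [Finite G] [Nonempty E]
    (h₀ : IsCMTypeWith ρ E₀) (hG : ∀ g : G, g • E₀ = E₀ ∨ g • E₀ = ρ • E₀) :
    Nonempty (G ≃* MulAction.stabilizer G E₀ × Subgroup.zpowers ρ) := by
  have hc := h₀.isComplement'_stabilizer_zpowers_rho hG
  have hcomm : ∀ (v : Subgroup.zpowers ρ) (g : G), (v : G) * g = g * v := fun v g => by
    rcases (h₀.mem_zpowers_rho_iff (v : G)).1 v.2 with h1 | h1
    · rw [h1, one_mul, mul_one]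
    · rw [h1, h₀.rho_mul_comm]
  let f : MulAction.stabilizer G E₀ × Subgroup.zpowers ρ →* G :=
    { toFun := fun x => (x.1 : G) * (x.2 : G)
      map_one' := by simp
      map_mul' := fun x y => by
        simp only [Prod.fst_mul, Prod.snd_mul, Subgroup.coe_mul]
        rw [mul_assoc, mul_assoc, ← mul_assoc (x.2 : G), hcomm x.2 (y.1 : G), mul_assoc] }
  have hf : Function.Bijective f := hc
  exact ⟨(MulEquiv.ofBijective f hf).symm⟩

/-- `⟨ρ⟩ ≃ ℤ₂`. [folklore] -/
private theorem nonempty_mulEquiv_zpowers_zmod_two [FaithfulSMul G E] [Nonempty E] (h₀ : IsCMTypeWith ρ E₀) :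
    Nonempty (Subgroup.zpowers ρ ≃* Multiplicative (ZMod 2)) := by
  have h2 := h₀.card_zpowers_rho
  haveI : Fact (Nat.Prime 2) := ⟨Nat.prime_two⟩
  haveI : IsCyclic (Subgroup.zpowers ρ) := isCyclic_of_prime_card (p := 2) h2
  exact ⟨mulEquivOfCyclicCardEq (by rw [h2, Nat.card_eq_fintype_card]; simp)⟩

open scoped Classical in
/-- **`G ≃ ℤ₂ × A₄` or `G ≃ ℤ₂ × S₄`**: a finite group acting faithfully and transitively on `E`, with a
`4`-element block `E₀` (a CM type mapped by everyone onto itself or its conjugate) and order divisible by `3`, is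
isomorphic to `ℤ₂ × A₄` or to `ℤ₂ × S₄` (`G = ⟨ρ⟩ × G₀`, `G₀ ↪ Sym(E₀)` with image `A₄` or `S₄`).
[cite: Dodson1984, §3.3.2 Theorem] -/
theorem nonempty_mulEquiv_of_block_four [FaithfulSMul G E] [Finite E] [Finite G]
    [MulAction.IsPretransitive G E] (h₀ : IsCMTypeWith ρ E₀) (hG : ∀ g : G, g • E₀ = E₀ ∨ g • E₀ = ρ • E₀)
    (h4 : E₀.ncard = 4) (h3 : 3 ∣ Nat.card G) :
    Nonempty (G ≃* Multiplicative (ZMod 2) × alternatingGroup (Fin 4)) ∨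
      Nonempty (G ≃* Multiplicative (ZMod 2) × Equiv.Perm (Fin 4)) := by
  letI : Fintype E₀ := Fintype.ofFinite E₀
  have hne : E₀.Nonempty := Set.nonempty_of_ncard_ne_zero (by rw [h4]; norm_num)
  haveI : Nonempty E := ⟨hne.some⟩
  haveI := h₀.faithfulSMul_stabilizer_of_block
  have hinj : Function.Injective (MulAction.toPermHom (MulAction.stabilizer G E₀) E₀) :=
    MulAction.toPerm_injective
  -- `E₀ ≃ Fin 4`
  have hcard4 : Fintype.card E₀ = 4 := by rw [← Nat.card_eq_fintype_card, Nat.card_coe_set_eq, h4]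
  let e4 : E₀ ≃ Fin 4 := Fintype.equivFinOfCardEq hcard4
  -- `G ≃ ⟨ρ⟩ × G₀`, `⟨ρ⟩ ≃ ℤ₂`, `G₀ ≃ range`
  obtain ⟨eG⟩ := h₀.nonempty_mulEquiv_stabilizer_prod_zpowers hG
  obtain ⟨eV⟩ := h₀.nonempty_mulEquiv_zpowers_zmod_two
  let eR : MulAction.stabilizer G E₀ ≃* (MulAction.toPermHom (MulAction.stabilizer G E₀) E₀).range :=
    MonoidHom.ofInjective hinj
  rcases h₀.range_toPermHom_eq_of_block_four hG h4 h3 with hA | hS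
  · left
    let eA : MulAction.stabilizer G E₀ ≃* alternatingGroup (Fin 4) :=
      (eR.trans (MulEquiv.subgroupCongr hA)).trans e4.altCongrHom
    exact ⟨eG.trans ((MulEquiv.prodCongr eA eV).trans MulEquiv.prodComm)⟩
  · right
    let eS : MulAction.stabilizer G E₀ ≃* Equiv.Perm (Fin 4) :=
      ((eR.trans (MulEquiv.subgroupCongr hS)).trans Subgroup.topEquiv).trans e4.permCongrHom
    exact ⟨eG.trans ((MulEquiv.prodCongr eS eV).trans MulEquiv.prodComm)⟩

end IsCMTypeWith

end GroupLevel

/-! ## Part II — octic CM fields: degenerate primitive types have sextic reflex fields -/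

section Octic

open NumberField IntermediateField
open Literature.AlgebraicGeometry.Motives (CMType)
open Literature.AlgebraicGeometry.Pohlmann1968

variable {K : Type} [Field K] [NumberField K] [IsCMField K]
variable {L : Type} [Field L] [NumberField L] [IsCMField L] [IsGalois ℚ L]

/-- An (imaginary) quadratic number field with one non-real embedding is totally complex (its two embeddings are
`τ₀` and `τ̄₀`). [folklore] -/
private theorem isTotallyComplex_of_conjugate_ne {k : Type*} [Field k] [NumberField k]
    (hk : Module.finrank ℚ k = 2) {τ₀ : k →+* ℂ} (hτ₀ : ComplexEmbedding.conjugate τ₀ ≠ τ₀) :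
    IsTotallyComplex k := by
  classical
  have hcard : Fintype.card (k →+* ℂ) = 2 := by rw [Embeddings.card, hk]
  have huniv : ({τ₀, ComplexEmbedding.conjugate τ₀} : Finset (k →+* ℂ)) = Finset.univ :=
    Finset.eq_univ_of_card _ (by rw [Finset.card_pair hτ₀.symm, hcard])
  refine ⟨fun v => ?_⟩
  rw [← InfinitePlace.not_isReal_iff_isComplex, InfinitePlace.isReal_iff]
  intro hreal
  have hmem : v.embedding ∈ ({τ₀, ComplexEmbedding.conjugate τ₀} : Finset (k →+* ℂ)) := by
    rw [huniv]; exact Finset.mem_univ _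
  simp only [Finset.mem_insert, Finset.mem_singleton] at hmem
  have hfix : ComplexEmbedding.conjugate v.embedding = v.embedding := hreal
  have hcc : ComplexEmbedding.conjugate (ComplexEmbedding.conjugate τ₀) = τ₀ := star_star τ₀
  rcases hmem with h1 | h1
  · exact hτ₀ (by rw [← h1]; exact hfix)
  · rw [h1, hcc] at hfix
    exact hτ₀ hfix.symm

/-- **`6 ≤ [K′ : ℚ]` for every PRIMITIVE octic CM type** — Ribet: `4 ≤ rank(Φ)` (`log₂`), and
`rank(Φ) = rank(Φ′) ≤ [K′ : ℚ]/2 + 1` (Kubota/Shimura §32.10); "if `d′ = 3` we have `rank(E,S) = 4`" is the extreme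
case. [cite: Dodson1984, §3.1.0 (p. 11)] [cite: Ribet1980, §3 (3.4)–(3.7) (pp. 86–88)] -/
theorem six_le_finrank_reflexField_of_isPrimitive (hK : Module.finrank ℚ K = 8) (j : K →ₐ[ℚ] L) (ι : L →+* ℂ)
    (Φ : CMType K) (φ₀ : K →+* ℂ) (hprim : IsPrimitive (ℂ ≃+* ℂ) Φ.1 φ₀) :
    6 ≤ Module.finrank ℚ (reflexField ℚ L (algValuedIn ι Φ.1)) := by
  classical
  have h45 := cmTypeRank_eq_four_or_eq_five hK φ₀ hprim (Φ := Φ)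
  have hW := isCMTypeWith_conjGal_algValuedIn ι Φ
  have hle := hW.typeRank_le_card_orbit j
  rw [typeRank_algValuedIn_eq_cmTypeRank j ι Φ, ← finrank_reflexField_eq_card_orbit] at hle
  omega

/-- **A DEGENERATE primitive octic CM type has `[K′ : ℚ] ≤ 6`**: `Φ` has multiplicities `(2,2)` over an imaginary
quadratic subfield `k` (Moonen–Zarhin / Gordon 5.13, tree `isNondegenerate_iff_forall_not_weilFibre`), so its Galois
translates, read on the `4`-element block of `k`, are `2`-subsets of the block: `[K′ : ℚ] = |G • Φ| ≤ C(4,2) = 6`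
("the `G`-orbit of `f` is `G₀*(f) ∪ G₀*(ρf)`"). [cite: Dodson1984, §3.3.2 Theorem; §3.1.1 Theorem (proof)]
[cite: MoonenZarhin1995Duke, Thm. 2.4] -/
theorem finrank_reflexField_le_six_of_not_isNondegenerate (hK : Module.finrank ℚ K = 8) (j : K →ₐ[ℚ] L)
    (ι : L →+* ℂ) (Φ : CMType K) (φ₀ : K →+* ℂ) (hprim : IsPrimitive (ℂ ≃+* ℂ) Φ.1 φ₀)
    (hdeg : ¬ IsNondegenerate Φ) :
    Module.finrank ℚ (reflexField ℚ L (algValuedIn ι Φ.1)) ≤ 6 := by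
  classical
  have h := (isNondegenerate_iff_forall_not_weilFibre hK φ₀ hprim).not.1 hdeg
  push Not at h
  obtain ⟨k, hk2, τ₀, hτ₀, hW⟩ := h
  haveI : IsTotallyComplex k := isTotallyComplex_of_conjugate_ne hk2 hτ₀
  -- the block has `[K : k] = 4` elements, `2` of them in `Φ`
  have hfib : (Finset.univ.filter fun φ : K →+* ℂ => φ.comp (algebraMap k K) = τ₀).card = 4 := by
    rw [card_fibre_eq_finrank (K := K) τ₀]
    have hmul := Module.finrank_mul_finrank ℚ k K
    rw [hk2, hK] at hmul
    omega
  have ha : {φ : K →+* ℂ | φ.comp (algebraMap k K) = τ₀ ∧ φ ∈ Φ.1}.ncard = 2 := by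
    have h2 := card_fibre_eq_two_mul (algebraMap k K : k →+* K) hW τ₀
    rw [hfib] at h2
    omega
  have hset1 : {φ : K →+* ℂ | φ ∈ Φ.1 ∧ φ.comp (algebraMap k K : k →+* K) = τ₀} =
      {φ : K →+* ℂ | φ.comp (algebraMap k K) = τ₀ ∧ φ ∈ Φ.1} := by
    ext φ; simp only [Set.mem_setOf_eq]; tauto
  have hset2 : {φ : K →+* ℂ | φ ∉ Φ.1 ∧ φ.comp (algebraMap k K : k →+* K) = τ₀} =
      {φ : K →+* ℂ | φ.comp (algebraMap k K) = τ₀ ∧ φ ∉ Φ.1} := by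
    ext φ; simp only [Set.mem_setOf_eq]; tauto
  have key := finrank_reflexField_le_choose_of_ringHom hk2 (algebraMap k K : k →+* K) j ι τ₀ Φ
    (by rw [hset1, hset2]; exact hW τ₀)
  rw [hset1, ha, hK] at key
  exact key.trans (by decide)

/-- **Dodson §3.3.2, the refinement: a degenerate simple CM abelian fourfold is the reflex of a sextic CM type** —
for `K` a CM field of degree `8` and `Φ` a PRIMITIVE CM type of `K` which is DEGENERATE (rank `4`), the reflex field
`K′(Φ)` has degree exactly `6` ("`(K, Φ)` is the reflex of a type on a CM-field of degree `6`").
[cite: Dodson1984, §3.3.2 Theorem] -/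
theorem finrank_reflexField_eq_six_of_not_isNondegenerate (hK : Module.finrank ℚ K = 8) (j : K →ₐ[ℚ] L)
    (ι : L →+* ℂ) (Φ : CMType K) (φ₀ : K →+* ℂ) (hprim : IsPrimitive (ℂ ≃+* ℂ) Φ.1 φ₀)
    (hdeg : ¬ IsNondegenerate Φ) :
    Module.finrank ℚ (reflexField ℚ L (algValuedIn ι Φ.1)) = 6 :=
  le_antisymm (finrank_reflexField_le_six_of_not_isNondegenerate hK j ι Φ φ₀ hprim hdeg)
    (six_le_finrank_reflexField_of_isPrimitive hK j ι Φ φ₀ hprim)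

omit [IsCMField K] in
/-- **Kubota's necessary condition** ("`[K′ : ℚ] ≥ [K : ℚ]` is a necessary condition for `(K, Φ)` to be
nondegenerate"): a CM type of an octic field whose reflex field has degree `< 8` is degenerate (no primitivity
needed). [cite: Dodson1984, §3.1.0 (p. 11)] -/
theorem not_isNondegenerate_of_finrank_reflexField_lt (hK : Module.finrank ℚ K = 8) (j : K →ₐ[ℚ] L)
    (ι : L →+* ℂ) (Φ : CMType K) (hlt : Module.finrank ℚ (reflexField ℚ L (algValuedIn ι Φ.1)) < 8) :
    ¬ IsNondegenerate Φ := fun hΦ => by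
  have := finrank_le_finrank_reflexField_of_isNondegenerate j ι hΦ
  omega

/-- **Dodson §3.3.2 in reflex form: a simple CM abelian fourfold is degenerate iff its CM type is the reflex of a
sextic type** — for a PRIMITIVE CM type `Φ` of an octic CM field: `Φ` degenerate ⟺ `[K′(Φ) : ℚ] = 6`.
[cite: Dodson1984, §3.3.2 Theorem] -/
theorem not_isNondegenerate_iff_finrank_reflexField_eq_six (hK : Module.finrank ℚ K = 8) (j : K →ₐ[ℚ] L)
    (ι : L →+* ℂ) (Φ : CMType K) (φ₀ : K →+* ℂ) (hprim : IsPrimitive (ℂ ≃+* ℂ) Φ.1 φ₀) :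
    ¬ IsNondegenerate Φ ↔ Module.finrank ℚ (reflexField ℚ L (algValuedIn ι Φ.1)) = 6 :=
  ⟨finrank_reflexField_eq_six_of_not_isNondegenerate hK j ι Φ φ₀ hprim,
    fun h6 => not_isNondegenerate_of_finrank_reflexField_lt hK j ι Φ (by omega)⟩

/-- **For simple CM fourfolds Kubota's necessary condition is sufficient**: a PRIMITIVE CM type `Φ` of an octic CM
field is nondegenerate ⟺ `[K : ℚ] ≤ [K′(Φ) : ℚ]`. [cite: Dodson1984, §3.3.2 Theorem; §3.1.0 (p. 11)] -/
theorem isNondegenerate_iff_finrank_le_finrank_reflexField (hK : Module.finrank ℚ K = 8) (j : K →ₐ[ℚ] L)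
    (ι : L →+* ℂ) (Φ : CMType K) (φ₀ : K →+* ℂ) (hprim : IsPrimitive (ℂ ≃+* ℂ) Φ.1 φ₀) :
    IsNondegenerate Φ ↔ Module.finrank ℚ K ≤ Module.finrank ℚ (reflexField ℚ L (algValuedIn ι Φ.1)) := by
  refine ⟨finrank_le_finrank_reflexField_of_isNondegenerate j ι, fun hle => ?_⟩
  by_contra hdeg
  have := finrank_reflexField_eq_six_of_not_isNondegenerate hK j ι Φ φ₀ hprim hdeg
  omega

/-- **The reflex degree of a primitive octic CM type is `6` or at least `8`** (`6` exactly in the degenerate case).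
[cite: Dodson1984, §3.3.2 Theorem; §3.1.0 (p. 11)] -/
theorem finrank_reflexField_eq_six_or_eight_le (hK : Module.finrank ℚ K = 8) (j : K →ₐ[ℚ] L) (ι : L →+* ℂ)
    (Φ : CMType K) (φ₀ : K →+* ℂ) (hprim : IsPrimitive (ℂ ≃+* ℂ) Φ.1 φ₀) :
    Module.finrank ℚ (reflexField ℚ L (algValuedIn ι Φ.1)) = 6 ∨
      8 ≤ Module.finrank ℚ (reflexField ℚ L (algValuedIn ι Φ.1)) := by
  by_cases hΦ : IsNondegenerate Φ
  · right
    have := finrank_le_finrank_reflexField_of_isNondegenerate j ι hΦ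
    omega
  · exact Or.inl (finrank_reflexField_eq_six_of_not_isNondegenerate hK j ι Φ φ₀ hprim hΦ)

/-- **`(K, Φ)` is the reflex of the sextic pair `(K′, Φ′)`**: in the degenerate case the reflex field `K′` has
degree `6` and the reflex field of the reflex type `Φ′ = reflexType ℚ L (algValuedIn ι Φ) j` (a CM type of `K′`)
is `j(K)` itself ("`(K′)′ = K` if and only if `(K, Φ)` is primitive"; the double reflex induces `Φ`,
`image_typeLift_reflexType_reflexType`). [cite: Dodson1984, §3.3.2 Theorem; §3.1.0 (p. 11)] -/
theorem reflexField_reflexType_eq_of_not_isNondegenerate (hK : Module.finrank ℚ K = 8) (j : K →ₐ[ℚ] L)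
    (ι : L →+* ℂ) (Φ : CMType K) (φ₀ : K →+* ℂ) (hprim : IsPrimitive (ℂ ≃+* ℂ) Φ.1 φ₀)
    (hdeg : ¬ IsNondegenerate Φ) :
    Module.finrank ℚ (reflexField ℚ L (algValuedIn ι Φ.1)) = 6 ∧
      reflexField ℚ L (reflexType ℚ L (algValuedIn ι Φ.1) j) = j.fieldRange :=
  ⟨finrank_reflexField_eq_six_of_not_isNondegenerate hK j ι Φ φ₀ hprim hdeg,
    ((isPrimitive_algValuedIn_iff j ι Φ.1 j φ₀).2 hprim).reflexField_reflexType_eq⟩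

/-! ### The Galois group of the Galois closure: `v = 1`, order `24` or `48`, `ℤ₂ × A₄` or `ℤ₂ × S₄` -/

/-- The data behind a degenerate primitive octic type: an imaginary quadratic subfield `k` with a non-real
embedding `τ₀`, over which `Φ` is balanced. [cite: MoonenZarhin1995Duke, Thm. 2.4]
[cite: Gordon1999HodgeAVSurvey, 5.13 (ii)] -/
private theorem exists_weilSubfield_of_not_isNondegenerate (hK : Module.finrank ℚ K = 8) (Φ : CMType K)
    (φ₀ : K →+* ℂ) (hprim : IsPrimitive (ℂ ≃+* ℂ) Φ.1 φ₀) (hdeg : ¬ IsNondegenerate Φ) :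
    ∃ k : IntermediateField ℚ K, Module.finrank ℚ k = 2 ∧ ∃ τ₀ : k →+* ℂ,
      ComplexEmbedding.conjugate τ₀ ≠ τ₀ ∧
        ∀ τ : k →+* ℂ, {φ : K →+* ℂ | φ.comp (algebraMap k K) = τ ∧ φ ∈ Φ.1}.ncard =
          {φ : K →+* ℂ | φ.comp (algebraMap k K) = τ ∧ φ ∉ Φ.1}.ncard := by
  have h := (isNondegenerate_iff_forall_not_weilFibre hK φ₀ hprim).not.1 hdeg
  push Not at h
  exact h

omit [IsGalois ℚ L] in
/-- **`v = 1`: `[Kᶜ : K₀ᶜ] = 2`** for the CM field of a degenerate simple CM fourfold (`K` contains an imaginary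
quadratic field; Dodson §3.1.1, first assertion; `L = Kᶜ` a normal closure, `K₀ᶜ = normalClosure ℚ K⁺ L`).
[cite: Dodson1984, §3.3.2 Theorem; §3.1.1 Theorem] -/
theorem finrank_normalClosure_maximalRealSubfield_eq_two_of_not_isNondegenerate [IsNormalClosure ℚ K L]
    (hK : Module.finrank ℚ K = 8) (j : K →ₐ[ℚ] L) (Φ : CMType K) (φ₀ : K →+* ℂ)
    (hprim : IsPrimitive (ℂ ≃+* ℂ) Φ.1 φ₀) (hdeg : ¬ IsNondegenerate Φ) :
    Module.finrank (normalClosure ℚ (maximalRealSubfield K) L) L = 2 := by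
  obtain ⟨k, hk2, τ₀, hτ₀, -⟩ := exists_weilSubfield_of_not_isNondegenerate hK Φ φ₀ hprim hdeg
  haveI : IsTotallyComplex k := isTotallyComplex_of_conjugate_ne hk2 hτ₀
  exact finrank_normalClosure_maximalRealSubfield_eq_two_of_ringHom hk2 (algebraMap k K : k →+* K) j

/-- `3 ∣ |Gal(L/ℚ)|` when `L ⊇ K` is Galois CM and `Φ` is a degenerate primitive octic type of `K` (its `6`
translates form one orbit). [cite: Dodson1984, §3.3.2 Theorem; §1.3 Remark] -/
theorem three_dvd_card_gal_of_not_isNondegenerate (hK : Module.finrank ℚ K = 8) (j : K →ₐ[ℚ] L) (ι : L →+* ℂ)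
    (Φ : CMType K) (φ₀ : K →+* ℂ) (hprim : IsPrimitive (ℂ ≃+* ℂ) Φ.1 φ₀) (hdeg : ¬ IsNondegenerate Φ) :
    3 ∣ Nat.card (L ≃ₐ[ℚ] L) := by
  have h6 := finrank_reflexField_eq_six_of_not_isNondegenerate hK j ι Φ φ₀ hprim hdeg
  rw [finrank_reflexField_eq_card_orbit] at h6
  have hdvd := card_orbit_dvd_card (G := L ≃ₐ[ℚ] L) (algValuedIn ι Φ.1)
  rw [h6] at hdvd
  exact (Nat.dvd_trans ⟨2, rfl⟩ hdvd : 3 ∣ _)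

/-- **`|Gal(Kᶜ/ℚ)| = [Kᶜ : ℚ] ∈ {24, 48}`** for the CM field `K` of a degenerate simple CM abelian fourfold
("`Gal(Kᶜ/ℚ) = ℤ₂ × A₄`, or `ℤ₂ × S₄`"); `L = Kᶜ` a normal closure of `K`.
[cite: Dodson1984, §3.3.2 Theorem] -/
theorem finrank_normalClosure_eq_of_not_isNondegenerate [IsNormalClosure ℚ K L] (hK : Module.finrank ℚ K = 8)
    (j : K →ₐ[ℚ] L) (ι : L →+* ℂ) (Φ : CMType K) (φ₀ : K →+* ℂ) (hprim : IsPrimitive (ℂ ≃+* ℂ) Φ.1 φ₀)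
    (hdeg : ¬ IsNondegenerate Φ) :
    Module.finrank ℚ L = 24 ∨ Module.finrank ℚ L = 48 := by
  obtain ⟨k, hk2, τ₀, hτ₀, -⟩ := exists_weilSubfield_of_not_isNondegenerate hK Φ φ₀ hprim hdeg
  haveI : IsTotallyComplex k := isTotallyComplex_of_conjugate_ne hk2 hτ₀
  -- the block: the type induced from `(k, {τ₀})`, read in `Hom_ℚ(K, L)`
  set Φ₀ : CMType K := inducedCMType (algebraMap k K : k →+* K) (CMTypeCount.single hk2 τ₀) with hΦ₀
  have h₀ := isCMTypeWith_conjGal_algValuedIn ι Φ₀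
  have hG := smul_algValuedIn_eq_or_of_finrank_reflexField_eq_two j ι Φ₀
    (finrank_reflexField_algValuedIn_inducedCMType_single hk2 _ j ι τ₀)
  have h4 : (algValuedIn ι Φ₀.1).ncard = 4 := by rw [ncard_algValuedIn j ι, ncard_cmType_eq, hK]
  have h3 := three_dvd_card_gal_of_not_isNondegenerate hK j ι Φ φ₀ hprim hdeg
  rw [← IsGalois.card_aut_eq_finrank]
  exact h₀.card_eq_of_block_four hG h4 h3

/-- **"`Gal(Kᶜ/ℚ) = ℤ₂ × A₄`, or `ℤ₂ × S₄`"** for the CM field `K` of a DEGENERATE simple CM abelian fourfold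
(`Φ` primitive of rank `4`), `L = Kᶜ` a normal closure: the Galois group is isomorphic to `ℤ₂ × A₄` or to
`ℤ₂ × S₄` (`A₄ = alternatingGroup (Fin 4)`, `S₄ = Equiv.Perm (Fin 4)`). [cite: Dodson1984, §3.3.2 Theorem] -/
theorem nonempty_mulEquiv_gal_of_not_isNondegenerate [IsNormalClosure ℚ K L] (hK : Module.finrank ℚ K = 8)
    (j : K →ₐ[ℚ] L) (ι : L →+* ℂ) (Φ : CMType K) (φ₀ : K →+* ℂ) (hprim : IsPrimitive (ℂ ≃+* ℂ) Φ.1 φ₀)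
    (hdeg : ¬ IsNondegenerate Φ) :
    Nonempty ((L ≃ₐ[ℚ] L) ≃* Multiplicative (ZMod 2) × alternatingGroup (Fin 4)) ∨
      Nonempty ((L ≃ₐ[ℚ] L) ≃* Multiplicative (ZMod 2) × Equiv.Perm (Fin 4)) := by
  obtain ⟨k, hk2, τ₀, hτ₀, -⟩ := exists_weilSubfield_of_not_isNondegenerate hK Φ φ₀ hprim hdeg
  haveI : IsTotallyComplex k := isTotallyComplex_of_conjugate_ne hk2 hτ₀
  set Φ₀ : CMType K := inducedCMType (algebraMap k K : k →+* K) (CMTypeCount.single hk2 τ₀) with hΦ₀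
  have h₀ := isCMTypeWith_conjGal_algValuedIn ι Φ₀
  have hG := smul_algValuedIn_eq_or_of_finrank_reflexField_eq_two j ι Φ₀
    (finrank_reflexField_algValuedIn_inducedCMType_single hk2 _ j ι τ₀)
  have h4 : (algValuedIn ι Φ₀.1).ncard = 4 := by rw [ncard_algValuedIn j ι, ncard_cmType_eq, hK]
  have h3 := three_dvd_card_gal_of_not_isNondegenerate hK j ι Φ φ₀ hprim hdeg
  exact h₀.nonempty_mulEquiv_of_block_four hG h4 h3

open scoped Classical in
/-- **`Gal(Kᶜ/D) ≅ Gal(K₀ᶜ/ℚ)` is `A₄` or `S₄` on the block**: for EVERY block `Φ₀` of `K` (a CM type with quadratic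
reflex field `D`, e.g. the type induced from the imaginary quadratic subfield), the stabiliser `G₀ = Gal(Kᶜ/D)` acts
on the `4` embeddings of the block with image the alternating group or the full symmetric group.
[cite: Dodson1984, §3.3.2 Theorem] -/
theorem range_toPermHom_eq_of_not_isNondegenerate [IsNormalClosure ℚ K L] (hK : Module.finrank ℚ K = 8)
    (j : K →ₐ[ℚ] L) (ι : L →+* ℂ) (Φ : CMType K) (φ₀ : K →+* ℂ) (hprim : IsPrimitive (ℂ ≃+* ℂ) Φ.1 φ₀)
    (hdeg : ¬ IsNondegenerate Φ) (Φ₀ : CMType K) (h2 : Module.finrank ℚ (reflexField ℚ L (algValuedIn ι Φ₀.1)) = 2) :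
    letI : Fintype (algValuedIn ι Φ₀.1) := Fintype.ofFinite _
    (MulAction.toPermHom (MulAction.stabilizer (L ≃ₐ[ℚ] L) (algValuedIn ι Φ₀.1)) (algValuedIn ι Φ₀.1)).range =
        alternatingGroup (algValuedIn ι Φ₀.1) ∨
      (MulAction.toPermHom (MulAction.stabilizer (L ≃ₐ[ℚ] L) (algValuedIn ι Φ₀.1)) (algValuedIn ι Φ₀.1)).range =
        ⊤ := by
  have h₀ := isCMTypeWith_conjGal_algValuedIn ι Φ₀
  have hG := smul_algValuedIn_eq_or_of_finrank_reflexField_eq_two j ι Φ₀ h2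
  have h4 : (algValuedIn ι Φ₀.1).ncard = 4 := by rw [ncard_algValuedIn j ι, ncard_cmType_eq, hK]
  have h3 := three_dvd_card_gal_of_not_isNondegenerate hK j ι Φ φ₀ hprim hdeg
  exact h₀.range_toPermHom_eq_of_block_four hG h4 h3

end Octic

/-! ## Part III — the example: Mumford–Pohlmann's simple CM fourfolds have SEXTIC reflex fields -/

section Example

open NumberField
open Literature.AlgebraicGeometry.Motives (CMType)
open Literature.AlgebraicGeometry.Pohlmann1968
open Literature.AlgebraicGeometry.ComplexMultiplication (isPrimitive_ringEquiv_complex_iff)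
open Literature.NumberTheory.NumberFields.MumfordQuartic (F)

namespace MumfordFourfold

open Literature.AlgebraicGeometry.Pohlmann1968.MumfordFourfold

variable {L : Type} [Field L] [NumberField L] [IsCMField L] [IsGalois ℚ L]

/-- Mumford's Weil type `Φ_P` (`|P| = 2`) of the octic CM field `K = F(i)` is PRIMITIVE (tree: `weilType_primitive`)
and DEGENERATE (the fibre of `ℚ(i)` is an exceptional balanced `4`-set, tree `fibre_mem_pohlmannSets_diff_two`).
[cite: vanGeemen1994HodgeAV, Thm. 4.5 and 4.7] [cite: Pohlmann1968, Thm. 1 and §3] -/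
theorem isPrimitive_and_not_isNondegenerate_weilType {P : Finset (F →+* ℂ)} (hP : P.card = 2) (φ₀ : K →+* ℂ) :
    IsPrimitive (ℂ ≃+* ℂ) (weilType P).1 φ₀ ∧ ¬ IsNondegenerate (weilType P) := by
  have hprim : IsPrimitive (ℂ ≃+* ℂ) (weilType P).1 φ₀ :=
    (isPrimitive_ringEquiv_complex_iff (weilType P) φ₀).2 (weilType_primitive hP)
  refine ⟨hprim, fun hnd => ?_⟩
  have h := fibre_mem_pohlmannSets_diff_two hP
  exact h.2 ((isNondegenerate_iff_pohlmannSets_subset finrank_K φ₀ hprim).1 hnd h.1)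

/-- **Mumford–Pohlmann's simple CM fourfolds are reflexes of SEXTIC CM types**: the reflex field of `(K; Φ_P)`,
read in any Galois CM field `L ⊇ K`, has degree `6` (Dodson §3.3.2: "`(K, Φ)` is the reflex of a type on a
CM-field of degree `6`"). [cite: Dodson1984, §3.3.2 Theorem] [cite: vanGeemen1994HodgeAV, Thm. 4.5] -/
theorem finrank_reflexField_weilType_eq_six {P : Finset (F →+* ℂ)} (hP : P.card = 2) (j : K →ₐ[ℚ] L)
    (ι : L →+* ℂ) : Module.finrank ℚ (reflexField ℚ L (algValuedIn ι (weilType P).1)) = 6 := by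
  obtain ⟨φ₀⟩ : Nonempty (K →+* ℂ) := inferInstance
  have h := isPrimitive_and_not_isNondegenerate_weilType hP φ₀
  exact finrank_reflexField_eq_six_of_not_isNondegenerate finrank_K j ι (weilType P) φ₀ h.1 h.2

/-- **The Galois closure of Mumford–Pohlmann's octic CM field `K = F(i)` has degree `24` or `48`**
(`Gal(Kᶜ/ℚ) ≃ ℤ₂ × A₄` or `ℤ₂ × S₄`; `L = Kᶜ` a normal closure). [cite: Dodson1984, §3.3.2 Theorem] -/
theorem finrank_normalClosure_eq [IsNormalClosure ℚ K L] {P : Finset (F →+* ℂ)} (hP : P.card = 2)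
    (j : K →ₐ[ℚ] L) (ι : L →+* ℂ) : Module.finrank ℚ L = 24 ∨ Module.finrank ℚ L = 48 := by
  obtain ⟨φ₀⟩ : Nonempty (K →+* ℂ) := inferInstance
  have h := isPrimitive_and_not_isNondegenerate_weilType hP φ₀
  exact finrank_normalClosure_eq_of_not_isNondegenerate finrank_K j ι (weilType P) φ₀ h.1 h.2

/-- … and its Galois group is `ℤ₂ × A₄` or `ℤ₂ × S₄`. [cite: Dodson1984, §3.3.2 Theorem] -/
theorem nonempty_mulEquiv_gal [IsNormalClosure ℚ K L] {P : Finset (F →+* ℂ)} (hP : P.card = 2)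
    (j : K →ₐ[ℚ] L) (ι : L →+* ℂ) :
    Nonempty ((L ≃ₐ[ℚ] L) ≃* Multiplicative (ZMod 2) × alternatingGroup (Fin 4)) ∨
      Nonempty ((L ≃ₐ[ℚ] L) ≃* Multiplicative (ZMod 2) × Equiv.Perm (Fin 4)) := by
  obtain ⟨φ₀⟩ : Nonempty (K →+* ℂ) := inferInstance
  have h := isPrimitive_and_not_isNondegenerate_weilType hP φ₀
  exact nonempty_mulEquiv_gal_of_not_isNondegenerate finrank_K j ι (weilType P) φ₀ h.1 h.2

end MumfordFourfold

end Example

end Literature.NumberTheory.ComplexMultiplication
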